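import Literature.AnabelianGeometry.SemiGraphs.PullbackFunctor
import Literature.AnabelianGeometry.SemiGraphs.HomComposition
import Literature.AnabelianGeometry.SemiGraphs.BObjFunctors

/-!
# The pull-back functor of a composite of morphisms of semi-graphs of anabelioids ([SemiAnbd] Rmk 2.4.2, Rmk 2.11.1)

Mochizuki, *Semi-graphs of anabelioids*, Publ. RIMS **42** (2006) 221–322, §2, Remark 2.4.2 p. 26
(composites of 1-morphisms of semi-graphs of anabelioids "as if they are simply morphisms in a
category") and Remark 2.11.1 p. 32 (a morphism `𝒢 → ℋ` "determines, in a natural fashion, a morphism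
`B(𝒢) → B(ℋ)`", i.e. a pull-back functor `B(ℋ) ⥤ B(𝒢)`) [cite: MochizukiSemiAnbd2006, Rem. 2.11.1 p.32].

PROOF-ONLY companion (abc-iut cell; no definition of a notion, no named fact): FUNCTORIALITY of
`B(−)` under the composition `Hom.comp` of `HomComposition.lean` —

* `Hom.comp_pullbackObj_ψ_hom` — the gluing isomorphisms of `(ψ ∘ φ)^* X` and of `φ^* (ψ^* X)`
  COINCIDE (the pasted 2-cell `(ψ ∘ φ)_b` followed by `(ψ ∘ φ)_e^*` of the gluing of `X` is `φ_b`,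
  then `φ_e^*` of `ψ_{φ b}`, then `φ_e^* ψ_{φ e}^*` of the gluing of `X`, up to the re-indexing
  identities along `edgeOf (φ b) = φ (edgeOf b)`); the vertex and edge objects agree definitionally;
* `Hom.pullbackObj_comp`, `Hom.pullbackFunctor_comp` — hence `(ψ ∘ φ)^* X = φ^* (ψ^* X)` and
  `(φ.comp ψ).pullbackFunctor = ψ.pullbackFunctor ⋙ φ.pullbackFunctor` as EQUALITIES (consumers who
  transport along isomorphisms use `eqToIso` of the latter; its vertex / edge components are
  identities since the objects agree field by field);
* `Hom.pi1Map_comp_pullbackFunctor` — on fundamental groups, for the basepoint of `B(𝒢)` through a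
  vertex `v`: `π₁((ψ ∘ φ)^*) = π₁(ψ^*) ∘ π₁(φ^*)` as homomorphisms `Π_𝒢 → Π_𝒦` (the two target
  basepoints `(ψ ∘ φ)^* ⋙ ρ_v ⋙ F` and `ψ^* ⋙ φ^* ⋙ ρ_v ⋙ F` are the same functor).

This is the brick shared by the clause-transports of "finite étale coverings (print's sense,
`Hom.IsFiniteEtaleCoveringGlobal`) are stable under composition" (FACT-LIST row F-1478 c2 of
[SemiAnbd] Rmk 2.4.1, reduced to that closure property by `CoverticialRemark241OfComp.lean`).
Nothing here takes a side on [IUTchIII] Cor. 3.12.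
-/

namespace Literature.AnabelianGeometry.SemiGraphs

open CategoryTheory
open Literature.AnabelianGeometry.Anabelioids

universe w v₁ u₁ u

namespace SemiGraphOfAnabelioids

namespace Hom

variable {𝒢 ℋ 𝒦 : SemiGraphOfAnabelioids.{v₁, u₁, u}} (φ : Hom 𝒢 ℋ) (ψ : Hom ℋ 𝒦)

/-! ### Components of a composite (definitional bookkeeping) -/

/-- Vertex components of a composite: `(ψ ∘ φ)_v = ψ_{φ v} ∘ φ_v`. [cite: MochizukiSemiAnbd2006, Rem. 2.4.2 p.26] -/
theorem comp_φV (v : 𝒢.graph.Vertex) :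
    (φ.comp ψ).φV v = (φ.φV v).comp (ψ.φV (φ.base.vertexMap v)) := rfl

/-- Edge components of a composite, through the canonical intermediate edge.
[cite: MochizukiSemiAnbd2006, Rem. 2.4.2 p.26] -/
theorem comp_φE (e : 𝒢.graph.Edge) (e'' : 𝒦.graph.Edge) (h : (φ.comp ψ).base.edgeMap e = e'') :
    (φ.comp ψ).φE e e'' h = φ.over.compE ψ.over e e'' h := rfl

/-- The 2-cells of a composite are the pasted 2-cells `compCell`. [cite: MochizukiSemiAnbd2006, Rem. 2.4.2 p.26] -/
theorem comp_φB (b : 𝒢.graph.Branch) (v : 𝒢.graph.Vertex) (hb : 𝒢.graph.abuts b = some v) :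
    (φ.comp ψ).φB b v hb =
      φ.over.compCell ψ.over (𝒢.pull b v hb) (ℋ.graph.edgeOf (φ.base.branchMap b))
        (φ.base.edgeOf_branchMap b).symm
        (ℋ.pull (φ.base.branchMap b) (φ.base.vertexMap v) (φ.base.abuts_branchMap b v hb))
        (𝒦.graph.edgeOf (ψ.base.branchMap (φ.base.branchMap b)))
        (ψ.base.edgeOf_branchMap (φ.base.branchMap b)).symm
        (𝒦.pull (ψ.base.branchMap (φ.base.branchMap b)) (ψ.base.vertexMap (φ.base.vertexMap v))
          (ψ.base.abuts_branchMap _ _ (φ.base.abuts_branchMap b v hb)))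
        (φ.φB b v hb)
        (ψ.φB (φ.base.branchMap b) (φ.base.vertexMap v) (φ.base.abuts_branchMap b v hb)) := rfl

/-- Vertex objects of `(ψ ∘ φ)^* X` and of `φ^* (ψ^* X)` agree (definitionally).
[cite: MochizukiSemiAnbd2006, Rem. 2.11.1 p.32] -/
theorem comp_pullbackObj_S (X : 𝒦.BObj) (v : 𝒢.graph.Vertex) :
    ((φ.comp ψ).pullbackObj X).S v = (φ.pullbackObj (ψ.pullbackObj X)).S v := rfl

/-- Edge objects of `(ψ ∘ φ)^* X` and of `φ^* (ψ^* X)` agree (definitionally).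
[cite: MochizukiSemiAnbd2006, Rem. 2.11.1 p.32] -/
theorem comp_pullbackObj_T (X : 𝒦.BObj) (e : 𝒢.graph.Edge) :
    ((φ.comp ψ).pullbackObj X).T e = (φ.pullbackObj (ψ.pullbackObj X)).T e := rfl

/-! ### The gluing isomorphisms agree -/

/-- Re-indexing: the edge objects of a pull-back computed through two presentations `e₁`, `e₂` of the
image edge agree. [cite: MochizukiSemiAnbd2006, Rem. 2.11.1 p.32] -/
theorem φE_pullback_obj_T_eq (e : 𝒢.graph.Edge) (e₁ e₂ : ℋ.graph.Edge) (p₁ : φ.base.edgeMap e = e₁)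
    (p₂ : φ.base.edgeMap e = e₂) (A : ℋ.BObj) :
    (φ.φE e e₁ p₁).pullback.obj (A.T e₁) = (φ.φE e e₂ p₂).pullback.obj (A.T e₂) := by
  subst p₁; subst p₂; rfl

/-- Components of the gluing natural isomorphism of a pull-back: `φ_b`, then `φ_e^*` of the gluing of
the object, then a re-indexing identity. [cite: MochizukiSemiAnbd2006, Rem. 2.11.1 p.32] -/
theorem gluingIso_hom_app (b : 𝒢.graph.Branch) (v : 𝒢.graph.Vertex)
    (h : 𝒢.graph.abuts b = some v) (A : ℋ.BObj) :
    (φ.gluingIso b v h).hom.app A =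
      (φ.φB b v h).hom.app (A.S (φ.base.vertexMap v)) ≫
        (φ.φE (𝒢.graph.edgeOf b) (ℋ.graph.edgeOf (φ.base.branchMap b))
            (φ.base.edgeOf_branchMap b).symm).pullback.map
          (A.ψ (φ.base.branchMap b) (φ.base.vertexMap v) (φ.base.abuts_branchMap b v h)).hom ≫
        eqToHom (φ.φE_pullback_obj_T_eq (𝒢.graph.edgeOf b) _ _
          (φ.base.edgeOf_branchMap b).symm rfl A) := by
  simp only [Hom.gluingIso, Hom.reindexIso, Iso.trans_hom, NatTrans.comp_app,
    Functor.isoWhiskerLeft_hom, Functor.whiskerLeft_app, Functor.isoWhiskerRight_hom,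
    Functor.whiskerRight_app, eqToIso.hom, eqToHom_app]
  rfl

/-- The rewriting principle behind `comp_pullbackObj_ψ_hom`: for functors `F = G₀ ⋙ H` (an
EQUALITY), the two normal forms `(A ≫ H x ≫ eqToHom) ≫ F m ≫ eqToHom` and
`A ≫ H (x ≫ G₀ m ≫ eqToHom) ≫ eqToHom` with the same end points agree (pure `eqToHom` bookkeeping).
[folklore] -/
private theorem comp_normal_form_eq {C : Type*} [Category C] {D : Type*} [Category D] {E : Type*}
    [Category E] {H : D ⥤ E} {G₀ : C ⥤ D} {F : C ⥤ E} (hF : F = G₀ ⋙ H) {a₀ : E} {d : D}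
    {c c' : C} (A : a₀ ⟶ H.obj d) (x : d ⟶ G₀.obj c) (m : c ⟶ c') {t : E}
    (β : H.obj (G₀.obj c) = F.obj c) (α : F.obj c' = t) {d' : D} (α₂ : G₀.obj c' = d')
    (α₃ : H.obj d' = t) :
    (A ≫ H.map x ≫ eqToHom β) ≫ F.map m ≫ eqToHom α =
      A ≫ H.map (x ≫ G₀.map m ≫ eqToHom α₂) ≫ eqToHom α₃ := by
  subst hF; subst α₂; subst α
  obtain rfl : β = rfl := rfl
  obtain rfl : α₃ = rfl := rfl
  simp only [Functor.map_comp, Functor.comp_map, Category.assoc]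
  erw [eqToHom_refl, eqToHom_refl, eqToHom_refl, Category.id_comp, Category.comp_id,
    CategoryTheory.Functor.map_id, Category.comp_id]
  erw [Category.comp_id]

/-- The gluing of a pull-back along a COMPOSITE, in normal form: `φ_b`, then `φ_e^*` of `ψ_{φ b}`,
then the (identity) bridge between the two presentations of the intermediate edge, then
`(ψ ∘ φ)_e^*` of the gluing of `X`, then re-indexing. [cite: MochizukiSemiAnbd2006, Rem. 2.11.1 p.32] -/
theorem comp_gluingIso_hom_app (X : 𝒦.BObj) (b : 𝒢.graph.Branch) (v : 𝒢.graph.Vertex)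
    (h : 𝒢.graph.abuts b = some v) :
    ((φ.comp ψ).gluingIso b v h).hom.app X =
      ((φ.φB b v h).hom.app ((ψ.φV (φ.base.vertexMap v)).pullback.obj
          (X.S (ψ.base.vertexMap (φ.base.vertexMap v)))) ≫
        (φ.φE (𝒢.graph.edgeOf b) (ℋ.graph.edgeOf (φ.base.branchMap b))
            (φ.base.edgeOf_branchMap b).symm).pullback.map
          ((ψ.φB (φ.base.branchMap b) (φ.base.vertexMap v) (φ.base.abuts_branchMap b v h)).hom.app
            (X.S (ψ.base.vertexMap (φ.base.vertexMap v)))) ≫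
        eqToHom (congrArg
          (fun H : Anabelioids.Hom (𝒢.E (𝒢.graph.edgeOf b))
              (𝒦.E (𝒦.graph.edgeOf (ψ.base.branchMap (φ.base.branchMap b)))) =>
            H.pullback.obj ((𝒦.pull (ψ.base.branchMap (φ.base.branchMap b))
              (ψ.base.vertexMap (φ.base.vertexMap v))
              (ψ.base.abuts_branchMap _ _ (φ.base.abuts_branchMap b v h))).pullback.obj
                (X.S (ψ.base.vertexMap (φ.base.vertexMap v)))))
          (φ.over.compE_eq ψ.over (𝒢.graph.edgeOf b) (ℋ.graph.edgeOf (φ.base.branchMap b))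
            (φ.base.edgeOf_branchMap b).symm
            (𝒦.graph.edgeOf (ψ.base.branchMap (φ.base.branchMap b)))
            (ψ.base.edgeOf_branchMap (φ.base.branchMap b)).symm).symm)) ≫
        ((φ.comp ψ).φE (𝒢.graph.edgeOf b) (𝒦.graph.edgeOf (ψ.base.branchMap (φ.base.branchMap b)))
            ((φ.comp ψ).base.edgeOf_branchMap b).symm).pullback.map
          (X.ψ (ψ.base.branchMap (φ.base.branchMap b)) (ψ.base.vertexMap (φ.base.vertexMap v))
            (ψ.base.abuts_branchMap _ _ (φ.base.abuts_branchMap b v h))).hom ≫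
        eqToHom ((φ.comp ψ).φE_pullback_obj_T_eq (𝒢.graph.edgeOf b) _ _
          ((φ.comp ψ).base.edgeOf_branchMap b).symm rfl X) := by
  rw [gluingIso_hom_app, comp_φB]
  erw [HomOver.compCell_hom_app, HomOver.compEIso_hom_app]
  rfl

/-- The gluing of an ITERATED pull-back `φ^* (ψ^* X)`, in normal form: `φ_b`, then `φ_e^*` of
(`ψ_{φ b}`, then `ψ_{e₁}^*` of the gluing of `X`, then re-indexing), then re-indexing.
[cite: MochizukiSemiAnbd2006, Rem. 2.11.1 p.32] -/
theorem gluingIso_hom_app_pullbackObj (X : 𝒦.BObj) (b : 𝒢.graph.Branch) (v : 𝒢.graph.Vertex)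
    (h : 𝒢.graph.abuts b = some v) :
    (φ.gluingIso b v h).hom.app (ψ.pullbackObj X) =
      (φ.φB b v h).hom.app ((ψ.φV (φ.base.vertexMap v)).pullback.obj
          (X.S (ψ.base.vertexMap (φ.base.vertexMap v)))) ≫
        (φ.φE (𝒢.graph.edgeOf b) (ℋ.graph.edgeOf (φ.base.branchMap b))
            (φ.base.edgeOf_branchMap b).symm).pullback.map
          ((ψ.φB (φ.base.branchMap b) (φ.base.vertexMap v) (φ.base.abuts_branchMap b v h)).hom.app
              (X.S (ψ.base.vertexMap (φ.base.vertexMap v))) ≫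
            (ψ.φE (ℋ.graph.edgeOf (φ.base.branchMap b))
                (𝒦.graph.edgeOf (ψ.base.branchMap (φ.base.branchMap b)))
                (ψ.base.edgeOf_branchMap (φ.base.branchMap b)).symm).pullback.map
              (X.ψ (ψ.base.branchMap (φ.base.branchMap b)) (ψ.base.vertexMap (φ.base.vertexMap v))
                (ψ.base.abuts_branchMap _ _ (φ.base.abuts_branchMap b v h))).hom ≫
            eqToHom (ψ.φE_pullback_obj_T_eq (ℋ.graph.edgeOf (φ.base.branchMap b)) _ _
              (ψ.base.edgeOf_branchMap (φ.base.branchMap b)).symm rfl X)) ≫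
        eqToHom (φ.φE_pullback_obj_T_eq (𝒢.graph.edgeOf b) _ _
          (φ.base.edgeOf_branchMap b).symm rfl (ψ.pullbackObj X)) := by
  have hψ : ((ψ.pullbackObj X).ψ (φ.base.branchMap b) (φ.base.vertexMap v)
      (φ.base.abuts_branchMap b v h)).hom =
      (ψ.gluingIso (φ.base.branchMap b) (φ.base.vertexMap v)
        (φ.base.abuts_branchMap b v h)).hom.app X := rfl
  rw [gluingIso_hom_app, hψ, gluingIso_hom_app]
  rfl

/-- **The gluing isomorphisms of `(ψ ∘ φ)^* X` and `φ^* (ψ^* X)` coincide.** Along a branch `b` of `e`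
abutting to `v`, the gluing of `(ψ ∘ φ)^* X` is the pasted 2-cell `(ψ ∘ φ)_b` (= `φ_b`, then
`φ_e^*` of `ψ_{φ b}`, then the identity bridging the two presentations of the intermediate edge)
followed by `(ψ ∘ φ)_e^* = φ_e^* ψ_{φ e}^*` of the gluing of `X` and a re-indexing identity; that of
`φ^* (ψ^* X)` is `φ_b`, then `φ_e^*` of the gluing of `ψ^* X` (itself `ψ_{φ b}`, then `ψ_{e₁}^*` of
the gluing of `X`, then re-indexing), then re-indexing — the same morphism, the two edge functors
`(ψ ∘ φ)_e^*` and `ψ_{e₁}^* ⋙ φ_e^*` being equal (`HomOver.compE_eq`).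
[cite: MochizukiSemiAnbd2006, Rem. 2.11.1 p.32] -/
theorem comp_pullbackObj_ψ_hom (X : 𝒦.BObj) (b : 𝒢.graph.Branch) (v : 𝒢.graph.Vertex)
    (h : 𝒢.graph.abuts b = some v) :
    (((φ.comp ψ).pullbackObj X).ψ b v h).hom = ((φ.pullbackObj (ψ.pullbackObj X)).ψ b v h).hom := by
  change ((φ.comp ψ).gluingIso b v h).hom.app X = (φ.gluingIso b v h).hom.app (ψ.pullbackObj X)
  rw [comp_gluingIso_hom_app, gluingIso_hom_app_pullbackObj]
  exact comp_normal_form_eq (congrArg Anabelioids.Hom.pullback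
    (φ.over.compE_eq ψ.over (𝒢.graph.edgeOf b) (ℋ.graph.edgeOf (φ.base.branchMap b))
      (φ.base.edgeOf_branchMap b).symm (𝒦.graph.edgeOf (ψ.base.branchMap (φ.base.branchMap b)))
      (ψ.base.edgeOf_branchMap (φ.base.branchMap b)).symm)) _ _ _ _ _ _ _

/-! ### `(ψ ∘ φ)^* = φ^* ∘ ψ^*` -/

/-- **The pull-back of an object along a composite is the iterated pull-back** (an EQUALITY of objects
of `B(𝒢)`: vertex and edge objects agree definitionally, the gluing isomorphisms by
`comp_pullbackObj_ψ_hom`). [cite: MochizukiSemiAnbd2006, Rem. 2.11.1 p.32] -/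
theorem pullbackObj_comp (X : 𝒦.BObj) :
    (φ.comp ψ).pullbackObj X = φ.pullbackObj (ψ.pullbackObj X) := by
  change SemiGraphOfAnabelioids.BObj.mk _ _ _ = SemiGraphOfAnabelioids.BObj.mk _ _ _
  congr 1
  funext b v h
  exact Iso.ext (φ.comp_pullbackObj_ψ_hom ψ X b v h)

/-- **`(ψ ∘ φ)^* = φ^* ∘ ψ^*` as functors** (EQUALITY; `eqToIso` of it is the natural isomorphism
with identity vertex / edge components). [cite: MochizukiSemiAnbd2006, Rem. 2.11.1 p.32] -/
theorem pullbackFunctor_comp :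
    (φ.comp ψ).pullbackFunctor = ψ.pullbackFunctor ⋙ φ.pullbackFunctor := by
  refine CategoryTheory.Functor.ext (fun X => φ.pullbackObj_comp ψ X) (fun X X' g => ?_)
  have key : ∀ {A B A' B' : 𝒢.BObj} (hA : A = A') (hB : B = B') (f : A ⟶ B) (f' : A' ⟶ B'),
      (∀ v, HEq (f.fS v) (f'.fS v)) → (∀ e, HEq (f.fT e) (f'.fT e)) →
      f = eqToHom hA ≫ f' ≫ eqToHom hB.symm := by
    intro A B A' B' hA hB f f' hS hT
    subst hA; subst hB
    simp only [eqToHom_refl, Category.comp_id, Category.id_comp]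
    exact BObj.hom_ext _ _ (funext fun v => eq_of_heq (hS v)) (funext fun e => eq_of_heq (hT e))
  exact key (φ.pullbackObj_comp ψ X) (φ.pullbackObj_comp ψ X') _ _ (fun v => HEq.rfl)
    (fun e => HEq.rfl)

/-! ### Consequences at a basepoint -/

/-- The basepoint square of a composite: `(ψ ∘ φ)^* ⋙ ρ_v = ψ^* ⋙ φ^* ⋙ ρ_v` DEFINITIONALLY (both are
`ρ_{ψ φ v} ⋙ ψ_{φ v}^* ⋙ φ_v^*`). [cite: MochizukiSemiAnbd2006, Def. 2.1 p.23] -/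
theorem comp_pullbackFunctor_comp_ρ (v : 𝒢.graph.Vertex) :
    (φ.comp ψ).pullbackFunctor ⋙ 𝒢.ρ v = ψ.pullbackFunctor ⋙ φ.pullbackFunctor ⋙ 𝒢.ρ v := rfl

/-- **On fundamental groups, `π₁((ψ ∘ φ)^*) = π₁(ψ^*) ∘ π₁(φ^*)`** for the basepoint of `B(𝒢)` through a
vertex `v` (basepoint `F` of `𝒢_v`): the homomorphism `Π_𝒢 → Π_𝒦` induced by the composite is the
composite of the induced homomorphisms `Π_𝒢 → Π_ℋ → Π_𝒦` (the target basepoints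
`(ψ ∘ φ)^* ⋙ ρ_v ⋙ F` and `ψ^* ⋙ φ^* ⋙ ρ_v ⋙ F` of `B(𝒦)` are the same functor).
[cite: MochizukiSemiAnbd2006, Def. 2.1 p.23] -/
theorem pi1Map_comp_pullbackFunctor (v : 𝒢.graph.Vertex) (F : 𝒢.V v ⥤ FintypeCat.{w}) :
    pi1Map (φ.comp ψ).pullbackFunctor (𝒢.ρ v ⋙ F) =
      (pi1Map ψ.pullbackFunctor (φ.pullbackFunctor ⋙ 𝒢.ρ v ⋙ F)).comp
        (pi1Map φ.pullbackFunctor (𝒢.ρ v ⋙ F)) := by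
  refine MonoidHom.ext fun σ => Iso.ext (NatTrans.ext (funext fun X => ?_))
  change σ.hom.app ((φ.comp ψ).pullbackObj X) = σ.hom.app (φ.pullbackObj (ψ.pullbackObj X))
  exact eq_of_heq (congr_arg_heq (fun Y => σ.hom.app Y) (φ.pullbackObj_comp ψ X))

/-- Pointwise form of `pi1Map_comp_pullbackFunctor`. [cite: MochizukiSemiAnbd2006, Def. 2.1 p.23] -/
theorem pi1Map_comp_pullbackFunctor_apply (v : 𝒢.graph.Vertex) (F : 𝒢.V v ⥤ FintypeCat.{w})
    (σ : 𝒢.Pi v F) :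
    pi1Map (φ.comp ψ).pullbackFunctor (𝒢.ρ v ⋙ F) σ =
      pi1Map ψ.pullbackFunctor (φ.pullbackFunctor ⋙ 𝒢.ρ v ⋙ F)
        (pi1Map φ.pullbackFunctor (𝒢.ρ v ⋙ F) σ) := by
  rw [pi1Map_comp_pullbackFunctor]; rfl

end Hom

end SemiGraphOfAnabelioids

end Literature.AnabelianGeometry.SemiGraphs
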